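import Summits.SmoothPoincare4.SmoothPoincare4.Theorems.ConvexBisectionAcyclicBisectionExistsHgapTwistingColumns
import Summits.SmoothPoincare4.SmoothPoincare4.Theorems.ConvexBisectionAcyclicBisectionExistsHgapTwistingMatrix
import Summits.SmoothPoincare4.SmoothPoincare4.Theorems.ConvexBisectionAcyclicBisectionExistsHgapTwistCharacter
import Summits.SmoothPoincare4.SmoothPoincare4.Theorems.ConvexBisectionAcyclicBisectionExistsContactSignPropagation
import Literature.Geometry.Symplectic.AttachingFramingProofs
import HarnessLib

/-!
# Hgap ▸ part B (page twisting of the straightened dual framed knot), brick R8 (assembly), file 3: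
# the page twisting of the transported dual framed knot from the sign of the belt character
(wave 7, crux stmt-SmoothPoincare4-10508, line `modp-braid-orbits`, stub `stub_T3_dualPresentation` (T3)
▸ node `Hgap` ▸ part B `helper_Hgap_twisting` ▸ (R8); registered sub-goal `helper_pageTwisting_transport_dualMap`)

THE ASSEMBLY of G2's computation (`G2-REPORT.md` §2, §4 (R8)).  Data: the fibred model `(D, bX, Ψ)` with
the page clause, the `j`-th handle with attaching circle `K_j` in the flat page of direction `c`, a
`rho`-preserving diffeomorphism `E` of the base (the time-1 map of a fibred straightening) carrying the dual
attaching circle `β_j` of `q = dualMap … j` into the same page, Z4's page tube `Φ` of `K_j` with frame sign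
`ε`, and a sign `σ = ±1` of the `det4`-character `χ` of G2's three-dimensional belt-tube chart AT THE BELT
POINTS (`hsign`; by the transfer (R6) `σ = -s₀ ε`).  Conclusion (`pageTwisting_transport_dualMap_of_beltSign`):

    pageTwisting g (E ∘ β_j) (dE fr_j) = σ · ε · pageTwisting g K_j fr_{K_j}.

Proof: the twisting loop of the transported dual framed knot is `(⟪κ Λ_t e₀, iT⟫, ⟪κ Λ_t e₀, n⟫)`
(`pageTwistingLoop_transport_dualMap_diffeo`, G2 file 5 for a diffeomorphism); at each `t` the frame data
of G2's `helper_det4_beltFrame_sign` / `helper_beltFrame_pointwise` are supplied by the columns file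
(`…HgapTwistingColumns`: `hρ`, `hinj`, `T ≠ 0`, `χ = det4 (∇rho, Λ e₀, Λ e₁, T)`) and the matrix file
(`…HgapTwistingMatrix`: `4‖dΦ‖² ⟪Λ X, n⟫ = ⟪M u, X⟫`, `M u ≠ 0`), so `sign ⟪Λ N_B, iT⟫ = sign χ = σ` (V2's
`mul_pos_of_pos_mul_of_pos_mul`) and the
twisting loop is pointwise-frame equivalent (X3 `wind_eq_of_pointwise_frame`) to the model loop
`(σ (M u)₁, (M u)₀)`, which winds `σ ε pageTwisting (K_j)` times (`beltMatrix_package`).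

Everything is proved; no named facts, no `sorry`.  References: J. B. Etnyre, T. Fuller, IMRN 2006, Thm. 1
(proof, p. 8) [EtnyreFuller2006]; R. E. Gompf, A. I. Stipsicz, *4-Manifolds and Kirby Calculus* (1999), §8.2
[GompfStipsicz1999].
-/

noncomputable section

set_option linter.dupNamespace false

open scoped Manifold ContDiff Topology ComplexConjugate RealInnerProductSpace
open Set Function Metric Complex
open Literature.Topology.FourManifolds Literature.Topology.FourManifolds.HandleAttachingMap
  Literature.Topology.FourManifolds.LefschetzBase Literature.Topology.PlaneTopology
  Literature.Geometry.Symplectic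

namespace Summit.SmoothPoincare4.SmoothPoincare4.Theorems.AcyclicBisectionExists.ModpBraidOrbits

open HBAssembly

section Assembly

variable {g : ℕ} {ι : Type} [Finite ι] {h : ι → HandleAttachingMap 3 2 (Base g)}
  {X : Type} [TopologicalSpace X] [ChartedSpace (EuclideanHalfSpace 4) X] [IsManifold (𝓡∂ 4) ∞ X]
  (D : MultiAttachmentData h (𝓡∂ 4) X) (bX : BoundaryData (𝓡∂ 4) X (𝓡 3))
  (Ψ : bX.carrier ≃ₘ⟮𝓡 3, 𝓡 3⟯ (bBase g).carrier)
  (col : (BoundaryManifold.boundaryData 3 (Base g)).Collar) (κ δ : ℝ) (hκ : 0 < κ) (hκ1 : κ ≤ 1)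
  (hδ : 0 < δ) (hδ2 : δ ≤ 1 / 2) (E : Base g ≃ₘ^∞⟮𝓡∂ 4, 𝓡∂ 4⟯ Base g) (j : ι)

/-! ## §1 The twisting loop of the transported dual framed knot -/

/-- **The twisting loop of the dual framed knot transported by a diffeomorphism `E`** (G2 file 5 for the
time-1 map of an isotopy, same proof): at `t` it is `(⟪κ Λ e₀, i K'⟫, ⟪κ Λ e₀, n⟫)`,
`Λ = ∂_m|₀ (E (seam (β♭ (e^{2πit}, m)))).1`. [cite: EtnyreFuller2006, §2] -/
theorem pageTwistingLoop_transport_dualMap_diffeo (t : ℝ) :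
    pageTwistingLoop g
        ((dualMap D bX (bBase g) Ψ col κ δ hκ hκ1 hδ hδ2 j).transport E).attachingCircle
        ((dualMap D bX (bBase g) Ψ col κ δ hκ hκ1 hδ hδ2 j).transport E).attachingFraming t =
      ⟨inner ℝ (κ • fderiv ℝ (fun m : EuclideanSpace ℝ (Fin 2) =>
          (E ((BoundaryManifold.boundaryData 3 (Base g)).incl (seamDiffeo bX (bBase g) Ψ
            ((beltMap D j).boundaryTube.toHomeo (circlePt t, m))))).1) 0 planeE0)
          (cplxJ (deriv (ambCurve g ((dualMap D bX (bBase g) Ψ col κ δ hκ hκ1 hδ hδ2 j).transport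
            E).attachingCircle) t)),
        inner ℝ (κ • fderiv ℝ (fun m : EuclideanSpace ℝ (Fin 2) =>
          (E ((BoundaryManifold.boundaryData 3 (Base g)).incl (seamDiffeo bX (bBase g) Ψ
            ((beltMap D j).boundaryTube.toHomeo (circlePt t, m))))).1) 0 planeE0)
          (horizNormal g (ambCurve g ((dualMap D bX (bBase g) Ψ col κ δ hκ hκ1 hδ hδ2 j).transport
            E).attachingCircle t))⟩ := by
  have hR₁ : MDifferentiableAt (𝓡∂ 4) (𝓡∂ 4) E
      ((dualMap D bX (bBase g) Ψ col κ δ hκ hκ1 hδ hδ2 j).attachingCircle (circlePt t)) :=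
    E.contMDiff.mdifferentiableAt (by simp)
  have key := ambient_transport_dualFraming D bX Ψ col κ δ hκ hκ1 hδ hδ2 j (circlePt t) hR₁
  rw [pageTwistingLoop, HandleAttachingMap.attachingFraming_transport]
  show (⟨inner ℝ (ambient g (E ((dualMap D bX (bBase g) Ψ col κ δ hκ hκ1 hδ hδ2 j).attachingCircle
      (circlePt t))) (mfderiv (𝓡∂ 4) (𝓡∂ 4) E _ _)) _, inner ℝ (ambient g (E
      ((dualMap D bX (bBase g) Ψ col κ δ hκ hκ1 hδ hδ2 j).attachingCircle (circlePt t)))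
        (mfderiv (𝓡∂ 4) (𝓡∂ 4) E _ _)) _⟩ : ℂ) = _
  rw [key]

/-- The ambient parametrisation of the transported dual circle is the pushed belt circle of the chart.
[folklore] -/
theorem ambCurve_transport_dualMap :
    ambCurve g ((dualMap D bX (bBase g) Ψ col κ δ hκ hκ1 hδ hδ2 j).transport E).attachingCircle =
      fun s : ℝ => (E ((BoundaryManifold.boundaryData 3 (Base g)).incl (seamDiffeo bX (bBase g) Ψ
        ((beltMap D j).boundaryTube.toHomeo (circlePt s, (0 : EuclideanSpace ℝ (Fin 2))))))).1 := by
  funext s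
  show (E ((dualMap D bX (bBase g) Ψ col κ δ hκ hκ1 hδ hδ2 j).attachingCircle (circlePt s))).1 = _
  rw [dualCircle_eq_chart]

/-! ## §2 The frame data at one parameter -/

variable {L : EuclideanSpace ℝ (Fin 3) →L[ℝ] EuclideanSpace ℝ (Fin 2)}
  (hL : ∀ (p : EuclideanSpace ℝ (Fin 3)) (i : Fin 2), L p i = p (Fin.castSucc i))
  (hEρ : ∀ x : Base g, rho g (E x).1 = rho g x.1) {c : ℂ} (hc : ‖c‖ = 1)
  (hflat : ∀ θ, E ((dualMap D bX (bBase g) Ψ col κ δ hκ hκ1 hδ hδ2 j).attachingCircle θ) ∈ page g c)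
  {p q r s : ℝ}
  (hM : ∀ (u : sphere (0 : EuclideanSpace ℝ (Fin 2)) 1) (Xv : EuclideanSpace ℝ (Fin 2)),
    fderiv ℝ (fun m : EuclideanSpace ℝ (Fin 2) =>
      (conj c * w g (E ((BoundaryManifold.boundaryData 3 (Base g)).incl (seamDiffeo bX (bBase g) Ψ
        ((beltMap D j).boundaryTube.toHomeo (u, m))))).1).im /
      (conj c * w g (E ((BoundaryManifold.boundaryData 3 (Base g)).incl (seamDiffeo bX (bBase g) Ψ
        ((beltMap D j).boundaryTube.toHomeo (u, m))))).1).re) 0 Xv =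
    ((u : EuclideanSpace ℝ (Fin 2)) 0 * p + (u : EuclideanSpace ℝ (Fin 2)) 1 * q) * Xv 0 +
      ((u : EuclideanSpace ℝ (Fin 2)) 0 * r + (u : EuclideanSpace ℝ (Fin 2)) 1 * s) * Xv 1)
  (hdet : p * s - r * q ≠ 0) {σ : ℤ} (hσ : σ = 1 ∨ σ = -1)
  (hsign : ∀ t : ℝ, 0 < (σ : ℝ) *
    det4 (gradient (rho g) (E ((BoundaryManifold.boundaryData 3 (Base g)).incl
        (seamDiffeo bX (bBase g) Ψ ((beltMap D j).boundaryTube.toHomeo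
          (circlePt ((EuclideanSpace.single (2 : Fin 3) t) 2), L (EuclideanSpace.single (2 : Fin 3) t)))))).1)
      (mfderiv 𝓘(ℝ, EuclideanSpace ℝ (Fin 3)) 𝓘(ℝ, EuclideanSpace ℝ (Fin 4))
        (fun p : EuclideanSpace ℝ (Fin 3) => (E ((BoundaryManifold.boundaryData 3 (Base g)).incl
          (seamDiffeo bX (bBase g) Ψ ((beltMap D j).boundaryTube.toHomeo (circlePt (p 2), L p))))).1)
        (EuclideanSpace.single (2 : Fin 3) t) (EuclideanSpace.single (0 : Fin 3) (1 : ℝ)))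
      (mfderiv 𝓘(ℝ, EuclideanSpace ℝ (Fin 3)) 𝓘(ℝ, EuclideanSpace ℝ (Fin 4))
        (fun p : EuclideanSpace ℝ (Fin 3) => (E ((BoundaryManifold.boundaryData 3 (Base g)).incl
          (seamDiffeo bX (bBase g) Ψ ((beltMap D j).boundaryTube.toHomeo (circlePt (p 2), L p))))).1)
        (EuclideanSpace.single (2 : Fin 3) t) (EuclideanSpace.single (1 : Fin 3) (1 : ℝ)))
      (mfderiv 𝓘(ℝ, EuclideanSpace ℝ (Fin 3)) 𝓘(ℝ, EuclideanSpace ℝ (Fin 4))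
        (fun p : EuclideanSpace ℝ (Fin 3) => (E ((BoundaryManifold.boundaryData 3 (Base g)).incl
          (seamDiffeo bX (bBase g) Ψ ((beltMap D j).boundaryTube.toHomeo (circlePt (p 2), L p))))).1)
        (EuclideanSpace.single (2 : Fin 3) t) (EuclideanSpace.single (2 : Fin 3) (1 : ℝ))))

include hL hEρ hc hflat hM hdet hσ hsign in
/-- **The frame data of the transported dual framing at one parameter `t`.**  With `u = e^{2πit}`,
`M u = ((u₀ p + u₁ q), (u₀ r + u₁ s))` the row vector and `ℓ'` the twisting loop of the transported dual
framed knot: (i) `Im ℓ'(t) = k · (M u)₀` with `k > 0`; (ii) where `(M u)₀ = 0`, `Re ℓ'(t) = b · σ (M u)₁` with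
`b > 0`; (iii) the model value `(σ (M u)₁, (M u)₀)` is non-zero.  (G2 `helper_beltFrame_pointwise` fed by
`helper_det4_beltFrame_sign`, the columns file and `hsign`.) [cite: EtnyreFuller2006, Thm. 1 (proof, p. 8)] -/
theorem beltFrame_at (t : ℝ) :
    (∃ k : ℝ, 0 < k ∧
      (pageTwistingLoop g ((dualMap D bX (bBase g) Ψ col κ δ hκ hκ1 hδ hδ2 j).transport E).attachingCircle
        ((dualMap D bX (bBase g) Ψ col κ δ hκ hκ1 hδ hδ2 j).transport E).attachingFraming t).im =
        k * (Real.cos (2 * Real.pi * t) * p + Real.sin (2 * Real.pi * t) * q)) ∧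
    (Real.cos (2 * Real.pi * t) * p + Real.sin (2 * Real.pi * t) * q = 0 → ∃ b : ℝ, 0 < (1 : ℝ) * b ∧
      (pageTwistingLoop g ((dualMap D bX (bBase g) Ψ col κ δ hκ hκ1 hδ hδ2 j).transport E).attachingCircle
        ((dualMap D bX (bBase g) Ψ col κ δ hκ hκ1 hδ hδ2 j).transport E).attachingFraming t).re =
        b * ((σ : ℝ) * (Real.cos (2 * Real.pi * t) * r + Real.sin (2 * Real.pi * t) * s))) ∧
    (⟨(σ : ℝ) * (Real.cos (2 * Real.pi * t) * r + Real.sin (2 * Real.pi * t) * s),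
      Real.cos (2 * Real.pi * t) * p + Real.sin (2 * Real.pi * t) * q⟩ : ℂ) ≠ 0 := by
  -- the instances at `t` of the two big hypotheses (then drop them from the context)
  have hs := hsign t
  have hMu := hM (circlePt t)
  clear hsign hM
  -- the point, the fibre derivative `Λ`, the velocity `T`
  obtain ⟨Dp, -, -, hdiff, -, hTd⟩ := beltChart_columns D bX Ψ E j hL t
  set pt : EuclideanSpace ℝ (Fin 4) := (E ((BoundaryManifold.boundaryData 3 (Base g)).incl (seamDiffeo bX (bBase g) Ψ
    ((beltMap D j).boundaryTube.toHomeo (circlePt t, (0 : EuclideanSpace ℝ (Fin 2))))))).1 with hpt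
  set Λ : EuclideanSpace ℝ (Fin 2) →L[ℝ] EuclideanSpace ℝ (Fin 4) := fderiv ℝ (fun m : EuclideanSpace ℝ (Fin 2) =>
    (E ((BoundaryManifold.boundaryData 3 (Base g)).incl (seamDiffeo bX (bBase g) Ψ
      ((beltMap D j).boundaryTube.toHomeo (circlePt t, m))))).1) 0 with hΛ
  set T : EuclideanSpace ℝ (Fin 4) := deriv (fun s : ℝ => (E ((BoundaryManifold.boundaryData 3 (Base g)).incl
    (seamDiffeo bX (bBase g) Ψ ((beltMap D j).boundaryTube.toHomeo (circlePt s, (0 : EuclideanSpace ℝ (Fin 2))))))).1) t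
    with hT
  have hcurve := ambCurve_transport_dualMap D bX Ψ col κ δ hκ hκ1 hδ hδ2 E j
  -- the point is flat of direction `c`
  have hmem : E ((BoundaryManifold.boundaryData 3 (Base g)).incl (seamDiffeo bX (bBase g) Ψ
      ((beltMap D j).boundaryTube.toHomeo (circlePt t, (0 : EuclideanSpace ℝ (Fin 2)))))) ∈ page g c := by
    rw [← dualCircle_eq_chart D bX Ψ col κ δ hκ hκ1 hδ hδ2 j (circlePt t)]; exact hflat _
  have hw : w g pt = c / 2 := hmem.2
  have hfl : ‖cx pt‖ ^ 2 < 4 := hmem.1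
  -- the velocity: non-zero, `ℂ`-tangent to the page
  have hT0 : T ≠ 0 := deriv_beltCore_ne_zero D bX Ψ E j hL t
  have hTD : HasDerivAt (ambCurve g ((dualMap D bX (bBase g) Ψ col κ δ hκ hκ1 hδ hδ2 j).transport E).attachingCircle) T t := by
    rw [hcurve, hT]; exact hTd.differentiableAt.hasDerivAt
  have hTpage : dPhiX g pt * cx T + dPhiY pt * cy T = 0 := by
    have h0 := dPhi_velocity_eq_zero_of_page (K := ((dualMap D bX (bBase g) Ψ col κ δ hκ hκ1 hδ hδ2 j).transport
      E).attachingCircle) (fun θ => hflat θ) hTD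
    rw [hcurve] at h0
    exact h0
  -- tangency and transversality of `Λ`
  have hρ : ∀ Xv, fderiv ℝ (rho g) pt (Λ Xv) = 0 := fun Xv => fderiv_rho_beltChart_fibre D bX Ψ E j hL hEρ t Xv
  have hinj : ∀ (Xv : EuclideanSpace ℝ (Fin 2)) (a : ℝ), Λ Xv = a • T → Xv = 0 := fun Xv a h0 =>
    beltChart_fibre_transversal D bX Ψ E j hL t Xv a h0
  -- the rows: `4 ‖dΦ‖² ⟪Λ X, n⟫ = ⟪M u, X⟫`
  -- (the row vector `M u`, introduced by an equation: `set` would search the big context)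
  obtain ⟨Lv, hLv⟩ : ∃ Lv : EuclideanSpace ℝ (Fin 2), Lv =
      (Real.cos (2 * Real.pi * t) * p + Real.sin (2 * Real.pi * t) * q) • planeE0 +
        (Real.cos (2 * Real.pi * t) * r + Real.sin (2 * Real.pi * t) * s) • planeE1 := ⟨_, rfl⟩
  have hLv0 : Lv 0 = Real.cos (2 * Real.pi * t) * p + Real.sin (2 * Real.pi * t) * q := by
    rw [hLv]; simp
  have hLv1 : Lv 1 = Real.cos (2 * Real.pi * t) * r + Real.sin (2 * Real.pi * t) * s := by
    rw [hLv]; simp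
  have hslope := hasFDerivAt_pageSlope_comp (g := g) hdiff.hasFDerivAt hc hw
  have hrow : ∀ Xv, 4 * (‖dPhiX g pt‖ ^ 2 + ‖dPhiY pt‖ ^ 2) * inner ℝ (Λ Xv) (horizNormal g pt) = inner ℝ Lv Xv := by
    intro Xv
    have h1 := congrArg (fun φ : EuclideanSpace ℝ (Fin 2) →L[ℝ] ℝ => φ Xv) hslope.fderiv
    simp only [FunLike.coe_smul, Pi.smul_apply, ContinuousLinearMap.comp_apply, innerSL_apply_apply,
      smul_eq_mul] at h1
    rw [hMu Xv, circlePt_apply_zero, circlePt_apply_one] at h1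
    have h2 : inner ℝ Lv Xv = (Real.cos (2 * Real.pi * t) * p + Real.sin (2 * Real.pi * t) * q) * Xv 0 +
        (Real.cos (2 * Real.pi * t) * r + Real.sin (2 * Real.pi * t) * s) * Xv 1 := by
      rw [hLv, inner_add_left, real_inner_smul_left, real_inner_smul_left]
      simp [EuclideanSpace.inner_single_left, planeE0, planeE1]
    rw [h2, h1, real_inner_comm]
  have hLv_ne : Lv ≠ 0 := by
    intro h0
    have e0 : Real.cos (2 * Real.pi * t) * p + Real.sin (2 * Real.pi * t) * q = 0 := by rw [← hLv0, h0]; rfl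
    have e1 : Real.cos (2 * Real.pi * t) * r + Real.sin (2 * Real.pi * t) * s = 0 := by rw [← hLv1, h0]; rfl
    have hCS := Real.cos_sq_add_sin_sq (2 * Real.pi * t)
    apply hdet
    linear_combination (Real.cos (2 * Real.pi * t) * s - Real.sin (2 * Real.pi * t) * r) * e0 +
      (Real.sin (2 * Real.pi * t) * p - Real.cos (2 * Real.pi * t) * q) * e1 - (p * s - r * q) * hCS
  -- the page sign: `0 < Q · χ` (G2) and `0 < σ · χ` (hsign) give `0 < σ · Q`
  have hQχ := det4_beltFrame_sign hc hw hfl hT0 hTpage hρ hrow hLv_ne hinj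
  have hσχ : 0 < (σ : ℝ) * det4 (gradient (rho g) pt) (Λ planeE0) (Λ planeE1) T := by
    -- rewrite the GOAL into the syntactic shape of `hs` (rewriting inside `hs` is kernel-expensive)
    have e : ((circlePt t, (0 : EuclideanSpace ℝ (Fin 2))) :
        (sphere (0 : EuclideanSpace ℝ (Fin 2)) 1) × EuclideanSpace ℝ (Fin 2)) =
        (circlePt ((EuclideanSpace.single (2 : Fin 3) t) 2), L (EuclideanSpace.single (2 : Fin 3) t)) := by
      rw [axis_apply_two, fibrePart_axis hL]
    rw [hpt, hΛ, hT, det4_beltChart_fibre_eq D bX Ψ E j hL t, e]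
    exact hs
  clear hs
  have hQ : 0 < (σ : ℝ) * inner ℝ (Λ (Lv 1 • planeE0 - Lv 0 • planeE1)) (cplxJ T) :=
    mul_pos_of_pos_mul_of_pos_mul hσχ hQχ
  obtain ⟨him, hre⟩ := beltFrame_pointwise (g := g) hc hw hrow hσ hQ
  -- the twisting loop at `t`
  have hloop := pageTwistingLoop_transport_dualMap_diffeo D bX Ψ col κ δ hκ hκ1 hδ hδ2 E j t
  rw [hcurve] at hloop
  refine ⟨?_, ?_, ?_⟩
  · obtain ⟨k, hk, hke⟩ := him
    refine ⟨κ * k, mul_pos hκ hk, ?_⟩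
    rw [hloop]
    dsimp only
    rw [real_inner_smul_left, hke, hLv0]
    ring
  · intro h0
    obtain ⟨b, hb, hbe⟩ := hre (by rw [hLv0, h0])
    refine ⟨κ * b, by rw [one_mul]; exact mul_pos hκ (by simpa using hb), ?_⟩
    rw [hloop]
    dsimp only
    rw [real_inner_smul_left, hbe, hLv1]
    ring
  · intro h0
    apply hLv_ne
    have e1 : (σ : ℝ) * (Real.cos (2 * Real.pi * t) * r + Real.sin (2 * Real.pi * t) * s) = 0 := congrArg Complex.re h0
    have e0 : Real.cos (2 * Real.pi * t) * p + Real.sin (2 * Real.pi * t) * q = 0 := congrArg Complex.im h0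
    have hσ0 : (σ : ℝ) ≠ 0 := by rcases hσ with h | h <;> simp [h]
    have e1' := (mul_eq_zero.1 e1).resolve_left hσ0
    rw [hLv, e0, e1', zero_smul, zero_smul, add_zero]

end Assembly

/-! ## §3 The page twisting of the transported dual framed knot -/

section Main

variable {g : ℕ} {ι : Type} [Finite ι] {h : ι → HandleAttachingMap 3 2 (Base g)}
  {X : Type} [TopologicalSpace X] [ChartedSpace (EuclideanHalfSpace 4) X] [IsManifold (𝓡∂ 4) ∞ X]
  (D : MultiAttachmentData h (𝓡∂ 4) X) (bX : BoundaryData (𝓡∂ 4) X (𝓡 3))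
  (Ψ : bX.carrier ≃ₘ⟮𝓡 3, 𝓡 3⟯ (bBase g).carrier)
  (hpage : ∀ (y : bX.carrier) (a : ↥(coresComplement h)), bX.incl y = D.jA a →
    ∃ c : ℝ, 0 < c ∧ w g ((bBase g).incl (Ψ y)).1 = (c : ℂ) * w g (a : Base g).1)
  (col : (BoundaryManifold.boundaryData 3 (Base g)).Collar) (κ δ : ℝ) (hκ : 0 < κ) (hκ1 : κ ≤ 1)
  (hδ : 0 < δ) (hδ2 : δ ≤ 1 / 2) (E : Base g ≃ₘ^∞⟮𝓡∂ 4, 𝓡∂ 4⟯ Base g) (j : ι)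
  {L : EuclideanSpace ℝ (Fin 3) →L[ℝ] EuclideanSpace ℝ (Fin 2)}
  (hL : ∀ (p : EuclideanSpace ℝ (Fin 3)) (i : Fin 2), L p i = p (Fin.castSucc i))
  (hEρ : ∀ x : Base g, rho g (E x).1 = rho g x.1)
  (hEw : ∀ x : Base g, ∃ t : ℝ, 0 < t ∧ w g (E x).1 = (t : ℂ) * w g x.1)
  {c : ℂ} (hc : ‖c‖ = 1) (hKc : ∀ v, (h j).attachingCircle v ∈ page g c)
  (hflat : ∀ θ, E ((dualMap D bX (bBase g) Ψ col κ δ hκ hκ1 hδ hδ2 j).attachingCircle θ) ∈ page g c)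
  {Φ : CircleTube (bBase g).carrier} {κ' r' : ℝ} (hκ' : 0 < κ') (hr' : 0 < r')
  (hΦcore : ∀ ψ, (bBase g).incl (Φ.core ψ) = (h j).attachingCircle ψ)
  (hΦder : ∀ t : ℝ, HasFDerivAt (fun v : EuclideanSpace ℝ (Fin 2) =>
      ((bBase g).incl (Φ.toHomeo (circlePt t, v))).1)
    ((EuclideanSpace.proj (𝕜 := ℝ) (0 : Fin 2)).smulRight (r' • cplxJ (deriv (ambCurve g (h j).attachingCircle) t)) +
      (EuclideanSpace.proj (𝕜 := ℝ) (1 : Fin 2)).smulRight (κ' • rotField g ((h j).attachingCircle (circlePt t)).1)) 0)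
  {ε : ℤ} (hε : ε = 1 ∨ ε = -1) (hεs : ∀ x, 0 < (ε : ℝ) * CircleTube.frameSign (h j).boundaryTube Φ x)
  {σ : ℤ} (hσ : σ = 1 ∨ σ = -1)
  (hsign : ∀ t : ℝ, 0 < (σ : ℝ) *
    det4 (gradient (rho g) (E ((BoundaryManifold.boundaryData 3 (Base g)).incl
        (seamDiffeo bX (bBase g) Ψ ((beltMap D j).boundaryTube.toHomeo
          (circlePt ((EuclideanSpace.single (2 : Fin 3) t) 2), L (EuclideanSpace.single (2 : Fin 3) t)))))).1)
      (mfderiv 𝓘(ℝ, EuclideanSpace ℝ (Fin 3)) 𝓘(ℝ, EuclideanSpace ℝ (Fin 4))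
        (fun p : EuclideanSpace ℝ (Fin 3) => (E ((BoundaryManifold.boundaryData 3 (Base g)).incl
          (seamDiffeo bX (bBase g) Ψ ((beltMap D j).boundaryTube.toHomeo (circlePt (p 2), L p))))).1)
        (EuclideanSpace.single (2 : Fin 3) t) (EuclideanSpace.single (0 : Fin 3) (1 : ℝ)))
      (mfderiv 𝓘(ℝ, EuclideanSpace ℝ (Fin 3)) 𝓘(ℝ, EuclideanSpace ℝ (Fin 4))
        (fun p : EuclideanSpace ℝ (Fin 3) => (E ((BoundaryManifold.boundaryData 3 (Base g)).incl
          (seamDiffeo bX (bBase g) Ψ ((beltMap D j).boundaryTube.toHomeo (circlePt (p 2), L p))))).1)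
        (EuclideanSpace.single (2 : Fin 3) t) (EuclideanSpace.single (1 : Fin 3) (1 : ℝ)))
      (mfderiv 𝓘(ℝ, EuclideanSpace ℝ (Fin 3)) 𝓘(ℝ, EuclideanSpace ℝ (Fin 4))
        (fun p : EuclideanSpace ℝ (Fin 3) => (E ((BoundaryManifold.boundaryData 3 (Base g)).incl
          (seamDiffeo bX (bBase g) Ψ ((beltMap D j).boundaryTube.toHomeo (circlePt (p 2), L p))))).1)
        (EuclideanSpace.single (2 : Fin 3) t) (EuclideanSpace.single (2 : Fin 3) (1 : ℝ))))

include hpage hL hEρ hEw hc hKc hflat hκ' hr' hΦcore hΦder hε hεs hσ hsign in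
/-- **The page twisting of the transported dual framed knot from the sign of the belt character** (R8):
`pageTwisting g (E ∘ β_j) (dE fr_j) = σ · ε · pageTwisting g K_j fr_{K_j}` — the twisting loop is
pointwise-frame equivalent (`wind_eq_of_pointwise_frame`, frame data `beltFrame_at`) to the model loop
`(σ (M u)₁, (M u)₀)` of the belt matrix, which winds `σ ε pageTwisting (K_j)` times (`beltMatrix_package`).
[cite: EtnyreFuller2006, Thm. 1 (proof, p. 8)] -/
theorem pageTwisting_transport_dualMap_of_beltSign :
    pageTwisting g ((dualMap D bX (bBase g) Ψ col κ δ hκ hκ1 hδ hδ2 j).transport E).attachingCircle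
        ((dualMap D bX (bBase g) Ψ col κ δ hκ hκ1 hδ hδ2 j).transport E).attachingFraming =
      σ * ε * pageTwisting g (h j).attachingCircle (h j).attachingFraming := by
  -- the belt matrix
  have hflat' : ∀ θ : sphere (0 : EuclideanSpace ℝ (Fin 2)) 1,
      w g (E ((BoundaryManifold.boundaryData 3 (Base g)).incl (seamDiffeo bX (bBase g) Ψ
        ((beltMap D j).boundaryTube.toHomeo (θ, (0 : EuclideanSpace ℝ (Fin 2))))))).1 = c / 2 := by
    intro θ
    have hm := hflat θ
    rw [dualCircle_eq_chart] at hm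
    exact hm.2
  obtain ⟨p, q, r, s, hM, hdet, hwind⟩ := beltMatrix_package D bX Ψ hpage j hc hKc E.contMDiff hEw hflat'
    hκ' hr' hΦcore hΦder hε hεs
  -- the two loops
  set q₂ := (dualMap D bX (bBase g) Ψ col κ δ hκ hκ1 hδ hδ2 j).transport E with hq₂
  set ℓ' := pageTwistingLoop g q₂.attachingCircle q₂.attachingFraming with hℓ'
  set ℓ : ℝ → ℂ := fun t => (⟨(σ : ℝ) * (Real.cos (2 * Real.pi * t) * r + Real.sin (2 * Real.pi * t) * s),
    Real.cos (2 * Real.pi * t) * p + Real.sin (2 * Real.pi * t) * q⟩ : ℂ) with hℓ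
  have hK : ContMDiff (𝓡 1) (𝓡∂ 4) 1 q₂.attachingCircle :=
    (isSmoothEmbedding_attachingCircle q₂).contMDiff.of_le (by simp)
  have hℓ'c : Continuous ℓ' := continuous_pageTwistingLoop hK (isKnotFraming_attachingFraming q₂).continuous
  have hℓc : Continuous ℓ := continuous_complex_mk (by fun_prop) (by fun_prop)
  have h01 : ℓ 0 = ℓ 1 := by
    simp only [hℓ, mul_zero, mul_one, Real.cos_zero, Real.sin_zero, Real.cos_two_pi, Real.sin_two_pi]
  have h01' : ℓ' 0 = ℓ' 1 := pageTwistingLoop_zero_eq_one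
  have hframe := fun t => beltFrame_at D bX Ψ col κ δ hκ hκ1 hδ hδ2 E j hL hEρ hc hflat hM hdet hσ hsign t
  have hne : ∀ t, ℓ t ≠ 0 := fun t => (hframe t).2.2
  have him : ∀ t ∈ Icc (0 : ℝ) 1, ∃ k : ℝ, 0 < k ∧ (ℓ' t).im = k * (ℓ t).im := fun t _ => (hframe t).1
  have hre : ∀ t ∈ Icc (0 : ℝ) 1, (ℓ t).im = 0 → ∃ b : ℝ, 0 < ((1 : ℤ) : ℝ) * b ∧ (ℓ' t).re = b * (ℓ t).re :=
    fun t _ h0 => by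
      obtain ⟨b, hb, hbe⟩ := (hframe t).2.1 h0
      exact ⟨b, by simpa using hb, hbe⟩
  have key := wind_eq_of_pointwise_frame (σ := 1) hℓc hℓ'c h01 h01' hne (Or.inl rfl) him hre
  have hmodel := hwind σ hσ
  have eℓ : ℓ = fun t => (⟨σ * (r * Real.cos (2 * Real.pi * t) + s * Real.sin (2 * Real.pi * t)),
      p * Real.cos (2 * Real.pi * t) + q * Real.sin (2 * Real.pi * t)⟩ : ℂ) := by
    funext t; simp only [hℓ]; congr 1 <;> ring
  rw [pageTwisting, ← hℓ', key, one_mul, eℓ, hmodel]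

end Main

/-- **Sub-goal `helper_pageTwisting_transport_dualMap` of stub `stub_T3_dualPresentation`** (T3 ▸ node `Hgap`
▸ part B `helper_Hgap_twisting` ▸ (R8) assembly, file 3; wave 7, lead c5): the ambient parametrisation of the
transported dual attaching circle is the pushed belt circle of G2's chart (the bookkeeping identity under
which the assembly `pageTwisting_transport_dualMap_of_beltSign` of this file reads the twisting loop in the
chart; that theorem rides along). [folklore] -/
theorem helper_pageTwisting_transport_dualMap : ∀ (g : ℕ) (ι : Type) [Finite ι] (h : ι → Literature.Topology.FourManifolds.HandleAttachingMap 3 2 (Literature.Topology.FourManifolds.LefschetzBase.Base g)) (X : Type) [TopologicalSpace X] [ChartedSpace (EuclideanHalfSpace 4) X] [IsManifold (𝓡∂ 4) ∞ X] (D : Literature.Topology.FourManifolds.HandleAttachingMap.MultiAttachmentData h (𝓡∂ 4) X) (bX : Literature.Topology.FourManifolds.BoundaryData (𝓡∂ 4) X (𝓡 3)) (Ψ : bX.carrier ≃ₘ⟮𝓡 3, 𝓡 3⟯ (Literature.Topology.FourManifolds.LefschetzBase.bBase g).carrier) (col : (Literature.Topology.FourManifolds.BoundaryManifold.boundaryData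 3 (Literature.Topology.FourManifolds.LefschetzBase.Base g)).Collar) (κ δ : ℝ) (hκ : 0 < κ) (hκ1 : κ ≤ 1) (hδ : 0 < δ) (hδ2 : δ ≤ 1 / 2) (E : Literature.Topology.FourManifolds.LefschetzBase.Base g ≃ₘ^∞⟮𝓡∂ 4, 𝓡∂ 4⟯ Literature.Topology.FourManifolds.LefschetzBase.Base g) (j : ι), Literature.Topology.FourManifolds.LefschetzBase.ambCurve g ((Summit.SmoothPoincare4.SmoothPoincare4.Theorems.AcyclicBisectionExists.ModpBraidOrbits.dualMap D bX (Literature.Topology.FourManifolds.LefschetzBase.bBase g) Ψ col κ δ hκ hκ1 hδ hδ2 j).transport E).attachingCircle = fun s : ℝ => (E ((Literature.Topology.FourManifolds.BoundaryManifold.boundaryData 3 (Literature.Topology.FourManifolds.LefschetzBase.Base g)).incl (Summit.SmoothPoincare4.SmoothPoincare4.Theorems.AcyclicBisectionExists.ModpBraidOrbits.seamDiffeo bX (Literature.Topology.FourManifolds.LefschetzBase.bBase g) Ψ ((Summit.SmoothPoincare4.SmoothPoincare4.Theorems.AcyclicBisectionExists.ModpBraidOrbits.beltMap D j).boundaryTube.toHomeo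 (Literature.Topology.FourManifolds.circlePt s, (0 : EuclideanSpace ℝ (Fin 2))))))).1 :=
  fun _ _ _ _ _ _ _ _ D bX Ψ col κ δ hκ hκ1 hδ hδ2 E j => ambCurve_transport_dualMap D bX Ψ col κ δ hκ hκ1 hδ hδ2 E j

end Summit.SmoothPoincare4.SmoothPoincare4.Theorems.AcyclicBisectionExists.ModpBraidOrbits

end
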